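import Mathlib
import Summits.Ventures.PercRepro2.Defs
import Summits.Ventures.PercRepro2.Independence
import Summits.Ventures.PercRepro2.Graph
import Summits.Ventures.PercRepro2.Exploration
import Summits.Ventures.PercRepro2.Induced
import Summits.Ventures.PercRepro2.R2PrimeThreeReduction
import Summits.Ventures.PercRepro2.YBridge
import Summits.Ventures.PercRepro2.HCov
import Summits.Ventures.PercRepro2.HubModel
import Summits.Ventures.PercRepro2.HubLaw
import Summits.Ventures.PercRepro2.HubRootLaw
import Summits.Ventures.PercRepro2.HubConn
import Summits.Ventures.PercRepro2.HubBernstein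
import Summits.Ventures.PercRepro2.HubGc
import Summits.Ventures.PercRepro2.HubKron

/-!
# Harris certificates for the coefficient cubics `C_k(m)`
(blind cell PercRepro2, typer-1 g8; MINE2-HUB.md §2 (c), HUB-LEAN-SCOPE.md (S5) — reflection form)

The inner law lives on the five **consistent** patterns (`atomPat : Fin 5 → (Fin 3 → Bool)`:
all, `o|a₃b`, `a₃|ob`, `b|oa₃`, sep); a cubic `cub W m` in the eight-pattern masses restricts to
the five atoms when the inconsistent patterns carry no mass (`cub_eq_cub5`).

A **certificate** (`Cert`) is mine-2's data for one type vector: Harris blocks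
`(u, v, j, 2ℓ)` — the slack `Hslack u v m = P(U_u ∩ U_v) · S − P(U_u) · P(U_v)` of two of the
eight up-sets `upPat` times the atom `m_j` with multiplier `2ℓ ≥ 0` — and monomials
`(a, b, d, 2s)` with `2s ≥ 0`; its tensor `rhs c` has `cub5 (rhs c) m = Σ 2ℓ · Hslack · m_j + Σ 2s · m_a m_b m_d`
(`cub5_rhs`), nonnegative on the Harris region (`cub5_rhs_nonneg`).

Two tensors with the same symmetrisation `sym3` have the same cubic (`cub5_sym3`:
`cub5 (sym3 W) m = 6 · cub5 W m`).  Hence the coefficient identity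
`2 · sym3 (W5 k) = rhsK L k` (the symmetrised hub table of `k` against the symmetrised certificates
of `k` in the list `L`, which the kernel verifies in `HubKernelChunk0.lean` … `HubTheorem.lean`) gives
`C_k(m) ≥ 0`
(`Ck_nonneg_of_check`).
-/

namespace Summit.Ventures.PercRepro2.Hub

section Atoms

/-- The five consistent inner patterns, in mine-2's order: all, `o|a₃b`, `a₃|ob`, `b|oa₃`, sep
(pattern bits: `0 = o ~ a₃`, `1 = a₃ ~ b`, `2 = o ~ b`). -/
def atomPat : Fin 5 → (Fin 3 → Bool)
  | 0 => fun _ => true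
  | 1 => fun i => decide (i = 1)
  | 2 => fun i => decide (i = 2)
  | 3 => fun i => decide (i = 0)
  | 4 => fun _ => false

/-- A pattern is consistent iff it is transitive (not exactly two of the three connections). -/
def consistent (π : Fin 3 → Bool) : Bool :=
  (!(π 0 && π 1) || π 2) && (!(π 1 && π 2) || π 0) && (!(π 0 && π 2) || π 1)

/-- The atoms are distinct. -/
lemma atomPat_injective : Function.Injective atomPat := by decide

/-- The consistent patterns are exactly the atoms. -/
lemma consistent_iff (π : Fin 3 → Bool) : consistent π = true ↔ ∃ a, atomPat a = π := by
  revert π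
  decide

end Atoms

section Cubic5

variable {R : Type*} [CommRing R]

/-- A cubic in the five atom masses with coefficient tensor `W`. -/
def cub5 (W : Fin 5 → Fin 5 → Fin 5 → ℤ) (m : Fin 5 → R) : R :=
  ∑ a, ∑ b, ∑ d, (W a b d : R) * (m a * m b * m d)

/-- A sum over the patterns of a function vanishing off the atoms is a sum over the atoms. -/
lemma sum_atom (g : (Fin 3 → Bool) → R) (hg : ∀ π, consistent π = false → g π = 0) :
    ∑ π, g π = ∑ a, g (atomPat a) := by
  classical
  rw [← Finset.sum_image (f := g) (s := Finset.univ) (g := atomPat)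
    (fun a _ b _ h => atomPat_injective h)]
  symm
  refine Finset.sum_subset (Finset.subset_univ _) fun π _ hπ => hg π ?_
  by_contra h
  have h' : consistent π = true := by simpa using h
  obtain ⟨a, ha⟩ := (consistent_iff π).1 h'
  exact hπ (Finset.mem_image.2 ⟨a, Finset.mem_univ _, ha⟩)

/-- **Restriction to the atoms**: a cubic in the pattern masses is the cubic in the atom masses when
the inconsistent patterns carry no mass. -/
theorem cub_eq_cub5 (W : Tensor3) (m : (Fin 3 → Bool) → R)
    (hm : ∀ π, consistent π = false → m π = 0) :
    cub W m = cub5 (fun a b d => W (atomPat a) (atomPat b) (atomPat d)) (fun a => m (atomPat a)) := by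
  unfold cub cub5
  rw [sum_atom _ (fun π hπ => by simp [hm π hπ])]
  refine Finset.sum_congr rfl fun a _ => ?_
  rw [sum_atom _ (fun π hπ => by simp [hm π hπ])]
  refine Finset.sum_congr rfl fun b _ => ?_
  rw [sum_atom _ (fun π hπ => by simp [hm π hπ])]

/-- Cubics are additive in the tensor. -/
lemma cub5_add (W₁ W₂ : Fin 5 → Fin 5 → Fin 5 → ℤ) (m : Fin 5 → R) :
    cub5 (fun a b d => W₁ a b d + W₂ a b d) m = cub5 W₁ m + cub5 W₂ m := by
  simp only [cub5, Int.cast_add, add_mul, Finset.sum_add_distrib]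

/-- The cubic of a list sum of tensors is the list sum of the cubics. -/
lemma cub5_list_sum {α : Type*} (l : List α) (f : α → Fin 5 → Fin 5 → Fin 5 → ℤ) (m : Fin 5 → R) :
    cub5 (fun a b d => (l.map fun e => f e a b d).sum) m = (l.map fun e => cub5 (f e) m).sum := by
  induction l with
  | nil => simp [cub5]
  | cons e l ih =>
    simp only [List.map_cons, List.sum_cons]
    rw [← ih, ← cub5_add]

/-- The symmetrisation of a tensor: the sum over the six orderings. -/
def sym3 (W : Fin 5 → Fin 5 → Fin 5 → ℤ) : Fin 5 → Fin 5 → Fin 5 → ℤ := fun a b d =>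
  W a b d + W a d b + W b a d + W b d a + W d a b + W d b a

/-- Transposing the last two indices does not change the cubic. -/
lemma cub5_swap23 (W : Fin 5 → Fin 5 → Fin 5 → ℤ) (m : Fin 5 → R) :
    cub5 (fun a b d => W a d b) m = cub5 W m := by
  unfold cub5
  refine Finset.sum_congr rfl fun a _ => ?_
  rw [Finset.sum_comm]
  refine Finset.sum_congr rfl fun d _ => Finset.sum_congr rfl fun b _ => ?_
  ring

/-- Transposing the first two indices does not change the cubic. -/
lemma cub5_swap12 (W : Fin 5 → Fin 5 → Fin 5 → ℤ) (m : Fin 5 → R) :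
    cub5 (fun a b d => W b a d) m = cub5 W m := by
  unfold cub5
  rw [Finset.sum_comm]
  refine Finset.sum_congr rfl fun b _ => Finset.sum_congr rfl fun a _ =>
    Finset.sum_congr rfl fun d _ => ?_
  ring

/-- **Symmetrisation multiplies the cubic by six.** -/
theorem cub5_sym3 (W : Fin 5 → Fin 5 → Fin 5 → ℤ) (m : Fin 5 → R) :
    cub5 (sym3 W) m = 6 * cub5 W m := by
  have e1 : cub5 (fun a b d => W a d b) m = cub5 W m := cub5_swap23 W m
  have e2 : cub5 (fun a b d => W b a d) m = cub5 W m := cub5_swap12 W m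
  have e3 : cub5 (fun a b d => W b d a) m = cub5 W m :=
    (cub5_swap12 (fun a b d => W a d b) m).trans e1
  have e4 : cub5 (fun a b d => W d a b) m = cub5 W m :=
    (cub5_swap23 (fun a b d => W b a d) m).trans e2
  have e5 : cub5 (fun a b d => W d b a) m = cub5 W m :=
    (cub5_swap12 (fun a b d => W d a b) m).trans e4
  have : cub5 (sym3 W) m = cub5 W m + cub5 (fun a b d => W a d b) m +
      cub5 (fun a b d => W b a d) m + cub5 (fun a b d => W b d a) m +
      cub5 (fun a b d => W d a b) m + cub5 (fun a b d => W d b a) m := by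
    simp only [sym3, cub5, Int.cast_add, add_mul, Finset.sum_add_distrib]
  rw [this, e1, e2, e3, e4, e5]
  ring

end Cubic5

section Certificate

/-- The eight up-sets of the inner-pattern lattice used by the certificates (mine-2's order
`[0]`, `[0,3]`, `[0,2]`, `[0,2,3]`, `[0,1]`, `[0,1,3]`, `[0,1,2]`, `[0,1,2,3]`), as monotone Boolean
predicates on patterns. -/
def upPat : Fin 8 → (Fin 3 → Bool) → Bool
  | 0 => fun π => π 0 && π 1 && π 2
  | 1 => fun π => π 0
  | 2 => fun π => π 2
  | 3 => fun π => π 0 || π 2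
  | 4 => fun π => π 1
  | 5 => fun π => π 0 || π 1
  | 6 => fun π => π 1 || π 2
  | 7 => fun π => π 0 || π 1 || π 2

/-- The up-sets are monotone. -/
lemma upPat_mono (u : Fin 8) (π π' : Fin 3 → Bool) (h : ∀ i, π i = true → π' i = true)
    (hπ : upPat u π = true) : upPat u π' = true := by
  revert u π π'
  decide

/-- An up-set restricted to the atoms. -/
def upA (u : Fin 8) (a : Fin 5) : Bool := upPat u (atomPat a)

/-- The indicator of an up-set at an atom. -/
def iu (u : Fin 8) (a : Fin 5) : ℤ := if upA u a then 1 else 0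

/-- The quadratic tensor of the Harris slack of the up-sets `u`, `v`:
`Σ_{a b} Aq u v a b · m_a m_b = P(U_u ∩ U_v) · S − P(U_u) · P(U_v)`. -/
def Aq (u v : Fin 8) (a b : Fin 5) : ℤ := iu u a * iu v a - iu u a * iu v b

/-- A certificate for one type vector: Harris blocks `(u, v, j, 2ℓ)` and monomials `(a, b, d, 2s)`
(all coefficients doubled: the certificates have denominators `≤ 2`). -/
structure Cert where
  /-- Harris blocks `(u, v, j, 2ℓ)`: the slack of `(U_u, U_v)` times the atom `j`, multiplier `2ℓ`. -/
  H : List (Fin 8 × Fin 8 × Fin 5 × ℤ)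
  /-- Monomials `(a, b, d, 2s)` with `a ≤ b ≤ d`. -/
  M : List (Fin 5 × Fin 5 × Fin 5 × ℤ)

/-- The empty certificate (type vectors with a vanishing cubic). -/
def Cert.zero : Cert := ⟨[], []⟩

/-- The tensor of a certificate: Harris blocks as `Aq ⊗ [j]`, monomials on their sorted triple. -/
def rhs (c : Cert) : Fin 5 → Fin 5 → Fin 5 → ℤ := fun a b d =>
  (c.H.map fun e => Aq e.1 e.2.1 a b * (if e.2.2.1 = d then e.2.2.2 else 0)).sum +
    (c.M.map fun e => if e.1 = a ∧ e.2.1 = b ∧ e.2.2.1 = d then e.2.2.2 else 0).sum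

/-- All multipliers of a certificate are nonnegative. -/
def certNonneg (c : Cert) : Bool :=
  c.H.all (fun e => decide (0 ≤ e.2.2.2)) && c.M.all (fun e => decide (0 ≤ e.2.2.2))

variable {R : Type*} [CommRing R]

/-- The Harris slack of two up-sets in the atom masses: `P(U_u ∩ U_v) · S − P(U_u) · P(U_v)`. -/
def Hslack (u v : Fin 8) (m : Fin 5 → R) : R :=
  (∑ a, (iu u a : R) * iu v a * m a) * (∑ b, m b) -
    (∑ a, (iu u a : R) * m a) * (∑ b, (iu v b : R) * m b)

/-- The cubic of one Harris block. -/
lemma cub5_block (u v : Fin 8) (j : Fin 5) (x : ℤ) (m : Fin 5 → R) :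
    cub5 (fun a b d => Aq u v a b * (if j = d then x else 0)) m = x * (Hslack u v m * m j) := by
  unfold cub5
  have hd : ∀ a b : Fin 5, ∑ d, ((Aq u v a b * (if j = d then x else 0) : ℤ) : R) *
      (m a * m b * m d) = (Aq u v a b : R) * x * (m a * m b * m j) := by
    intro a b
    rw [Finset.sum_eq_single j]
    · simp
    · intro d _ hd
      simp [Ne.symm hd]
    · intro h
      exact absurd (Finset.mem_univ _) h
  simp only [hd]
  unfold Hslack Aq
  rw [Finset.sum_mul_sum, Finset.sum_mul_sum]
  simp only [← Finset.sum_sub_distrib, Finset.mul_sum, Finset.sum_mul]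
  refine Finset.sum_congr rfl fun a _ => Finset.sum_congr rfl fun b _ => ?_
  push_cast
  ring

/-- The cubic of one monomial. -/
lemma cub5_mono (a' b' d' : Fin 5) (x : ℤ) (m : Fin 5 → R) :
    cub5 (fun a b d => if a' = a ∧ b' = b ∧ d' = d then x else 0) m = x * (m a' * m b' * m d') := by
  unfold cub5
  rw [Finset.sum_eq_single a']
  · rw [Finset.sum_eq_single b']
    · rw [Finset.sum_eq_single d']
      · simp
      · intro d _ hd
        simp [Ne.symm hd]
      · intro h
        exact absurd (Finset.mem_univ _) h
    · intro b _ hb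
      simp [Ne.symm hb]
    · intro h
      exact absurd (Finset.mem_univ _) h
  · intro a _ ha
    simp [Ne.symm ha]
  · intro h
    exact absurd (Finset.mem_univ _) h

/-- **The cubic of a certificate**: Harris slacks times atoms plus monomials. -/
theorem cub5_rhs (c : Cert) (m : Fin 5 → R) :
    cub5 (rhs c) m =
      (c.H.map fun e => (e.2.2.2 : R) * (Hslack e.1 e.2.1 m * m e.2.2.1)).sum +
        (c.M.map fun e => (e.2.2.2 : R) * (m e.1 * m e.2.1 * m e.2.2.1)).sum := by
  unfold rhs
  rw [cub5_add, cub5_list_sum, cub5_list_sum]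
  congr 1
  · congr 1
    refine List.map_congr_left fun e _ => ?_
    exact cub5_block e.1 e.2.1 e.2.2.1 e.2.2.2 m
  · congr 1
    refine List.map_congr_left fun e _ => ?_
    exact cub5_mono e.1 e.2.1 e.2.2.1 e.2.2.2 m

end Certificate

section Positivity

variable {R : Type*} [CommRing R] [LinearOrder R] [IsStrictOrderedRing R]

/-- **A certificate is nonnegative on the Harris region.** -/
theorem cub5_rhs_nonneg (c : Cert) (hc : certNonneg c = true) (m : Fin 5 → R)
    (hm : ∀ a, 0 ≤ m a) (hH : ∀ u v, 0 ≤ Hslack u v m) : 0 ≤ cub5 (rhs c) m := by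
  rw [cub5_rhs]
  unfold certNonneg at hc
  rw [Bool.and_eq_true, List.all_eq_true, List.all_eq_true] at hc
  refine add_nonneg (List.sum_nonneg fun x hx => ?_) (List.sum_nonneg fun x hx => ?_)
  · obtain ⟨e, he, rfl⟩ := List.mem_map.1 hx
    have := hc.1 e he
    rw [decide_eq_true_eq] at this
    exact mul_nonneg (Int.cast_nonneg this) (mul_nonneg (hH _ _) (hm _))
  · obtain ⟨e, he, rfl⟩ := List.mem_map.1 hx
    have := hc.2 e he
    rw [decide_eq_true_eq] at this
    exact mul_nonneg (Int.cast_nonneg this) (mul_nonneg (mul_nonneg (hm _) (hm _)) (hm _))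

/-- The hub table of a type vector on the atoms. -/
def W5 (k : Fin 7 → Fin 4) : Fin 5 → Fin 5 → Fin 5 → ℤ := fun a b d =>
  Wtot k (atomPat a) (atomPat b) (atomPat d)

/-- The symmetrised certificates of a type vector in a certificate list (keyed by `idx4K`). -/
def rhsK (L : List (ℕ × Cert)) (k : Fin 7 → Fin 4) : Fin 5 → Fin 5 → Fin 5 → ℤ := fun a b d =>
  ((L.filter fun e => e.1 = idx4K k).map fun e => sym3 (rhs e.2) a b d).sum

/-- **Positivity of a coefficient cubic from its certificate**: if the symmetrised hub table of `k`
(doubled) equals its symmetrised certificates, and the inner masses vanish off the atoms, are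
nonnegative and satisfy the Harris inequalities, then `C_k(m) ≥ 0`. -/
theorem Ck_nonneg_of_check (L : List (ℕ × Cert)) (hL : L.all (fun e => certNonneg e.2) = true)
    (k : Fin 7 → Fin 4) (hker : ∀ a b d, 2 * sym3 (W5 k) a b d = rhsK L k a b d)
    (m : (Fin 3 → Bool) → R) (hm0 : ∀ π, consistent π = false → m π = 0)
    (hm : ∀ a, 0 ≤ m (atomPat a)) (hH : ∀ u v, 0 ≤ Hslack u v fun a => m (atomPat a)) :
    0 ≤ Ck m k := by
  rw [List.all_eq_true] at hL
  have key : 0 ≤ (12 : R) * Ck m k := by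
    have e1 : (12 : R) * Ck m k = cub5 (fun a b d => 2 * sym3 (W5 k) a b d) (fun a => m (atomPat a)) := by
      rw [Ck, cub_eq_cub5 _ _ hm0]
      have : cub5 (fun a b d => 2 * sym3 (W5 k) a b d) (fun a => m (atomPat a)) =
          2 * cub5 (sym3 (W5 k)) (fun a => m (atomPat a)) := by
        simp only [cub5, Int.cast_mul, Int.cast_ofNat, mul_assoc, Finset.mul_sum]
      rw [this, cub5_sym3]
      unfold W5
      ring
    rw [e1]
    have e2 : (fun a b d => 2 * sym3 (W5 k) a b d) = rhsK L k := by
      funext a b d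
      exact hker a b d
    rw [e2]
    unfold rhsK
    rw [cub5_list_sum]
    refine List.sum_nonneg fun x hx => ?_
    obtain ⟨e, he, rfl⟩ := List.mem_map.1 hx
    rw [cub5_sym3]
    have hc := hL e (List.mem_of_mem_filter he)
    exact mul_nonneg (by norm_num) (cub5_rhs_nonneg e.2 hc _ hm hH)
  by_contra hneg
  rw [not_le] at hneg
  have : (12 : R) * Ck m k < 0 := mul_neg_of_pos_of_neg (by norm_num) hneg
  linarith

end Positivity

end Summit.Ventures.PercRepro2.Hub
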